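import Literature.Computability.Complexity.TM2Window
import Literature.Computability.QuantumComplexity.WindowTableau
import Mathlib.Algebra.BigOperators.Group.Finset.Basic
import Mathlib.Data.Fintype.EquivFin
import HarnessLib

/-!
# The window machine of a `TM2` machine

Bridge between Mathlib's multi-stack machines `Turing.FinTM2` (through the window lemma of
`Literature.Computability.Complexity.TM2Window`) and the abstract window machines `WM` of
`Literature.Computability.QuantumComplexity.WindowTableau`, for the tableau simulation behind
`P ⊆ P/poly` and `BPP ⊆ BQP` (Sipser 2012, proof of Thm. 9.30; Arora–Barak 2009, proof of
Thm. 6.6; Bernstein–Vazirani 1997, proof of Thm. 8.3).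

For a machine `tm : FinTM2` we fix codes: labels `Option tm.Λ ≃ Fin nL` (`eL`), states
`tm.σ ≃ Fin nV` (`eV`), stacks `tm.K ≃ Fin κ` (`eK`), and cell codes `Fin A`,
`A = 1 + ∑ₖ #(effective alphabet of stack k)`: code `0` is the empty cell and `code k γ` the
code of an effective symbol `γ` (`TM2Sim.IsSym`, the symbols that can occur in a run;
`decode` inverts it). The window machine `wm tm` has window depth `depth tm` and its control
table runs one total step `TM2Sim.stepTotal` on the configuration decoded from a pattern
(`ctrlCfg`) and re-encodes the new label, state and top segments. The abstraction
`abs : tm.Cfg → (wm tm).Cfg` codes a configuration cell by cell.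

Main results: `abs_stepTotal` — on good configurations (all stack symbols effective) `abs`
commutes with one step (`abs (stepTotal tm c) = (wm tm).step (abs c)`), by
`TM2Sim.getElem?_stepTotal_stk`; its iterate `abs_iterate`; and the readings of initial and
halting configurations (`abs_initList_*`, `abs_haltList_cell`, `code_eq_code_iff`).

Relation to the tree: `Complexity/TM2Circuits.lean` restricts symbols to the same effective
alphabets, as the per-stack subtypes `FinTM2Sim.StackSym tm k = {γ // TM2Sim.IsSym tm k γ}`
with cells `∀ k, Option (StackSym tm k)` (also used by `Complexity/TableauStep.lean` and
`QuantumComplexity/RevTableau.lean`); the window machines of `WindowTableau.lean` instead take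
one numeric code space `Fin A` shared by all stacks (one-hot wires `(k, j, g)`, `g < A`), which
is what `symSet`/`code`/`decode` provide (`code k γ = 1 +` the index of `γ` in the effective
alphabet of stack `k`, `0` = empty), together with the numeric control `eL`, `eV`, `eK`.

On computability: `tm.Λ`, `tm.σ`, `tm.K` and the alphabets are arbitrary finite types, so the
numberings `eL`, `eV`, `eK`, `code` are bijections *chosen once* (`Fintype.equivFin`) — like
the transition table of `tm`, these finitely many numbers are constants of every circuit
description built on `wm tm`; a description-printing machine has them built into its program
(`SimUniformity.lean`) and never computes them, so their noncomputability in Lean is harmless.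

## References

* M. Sipser, *Introduction to the Theory of Computation*, 3rd ed. 2012, Thm. 9.30 (proof).
* S. Arora, B. Barak, *Computational Complexity: A Modern Approach*, CUP 2009, Thm. 6.6
  (proof), Lemma 10.10, Cor. 10.11.
* E. Bernstein, U. Vazirani, *Quantum complexity theory*, SIAM J. Comput. 26 (1997),
  Thm. 8.3 (proof).
-/

noncomputable section

namespace Literature.Computability.QuantumComplexity

open Turing Function Complexity Complexity.TM2Sim

attribute [local instance] Turing.FinTM2.kFin Turing.FinTM2.ΛFin Turing.FinTM2.σFin

namespace TM2Bridge

variable (tm : FinTM2)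

/-! ### Codes of labels, states, stacks and symbols -/

/-- The effective alphabet of stack `k` as a set. [folklore] -/
def symSet (k : tm.K) : Set (tm.Γ k) := {γ | IsSym tm k γ}

/-- The effective alphabets are finite types. [folklore] -/
instance fintypeSymSet (k : tm.K) : Fintype (symSet tm k) := (finite_isSym tm k).fintype

/-- The number of effective symbols of stack `k`. [folklore] -/
def nSym (k : tm.K) : ℕ := Fintype.card (symSet tm k)

/-- The number of cell codes: `0` for the empty cell, then the effective symbols of all
stacks. [folklore] -/
def A : ℕ := (∑ k, nSym tm k) + 1

/-- There is at least one cell code (the empty one). -/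
instance neZeroA : NeZero (A tm) := ⟨Nat.succ_ne_zero _⟩

/-- Every effective alphabet fits into the cell codes. [folklore] -/
theorem nSym_lt_A (k : tm.K) : nSym tm k < A tm := by
  have : nSym tm k ≤ ∑ k, nSym tm k :=
    Finset.single_le_sum (f := fun k => nSym tm k) (fun _ _ => Nat.zero_le _) (Finset.mem_univ k)
  unfold A; omega

open Classical in
/-- The code of a symbol of stack `k`: `1 +` its index in the effective alphabet, and `0`
(the empty-cell code) for symbols that cannot occur in a run. [folklore] -/
def code (k : tm.K) (γ : tm.Γ k) : Fin (A tm) :=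
  if h : IsSym tm k γ then
    ⟨(Fintype.equivFin (symSet tm k) ⟨γ, h⟩ : ℕ) + 1, by
      have := (Fintype.equivFin (symSet tm k) ⟨γ, h⟩).2
      have := nSym_lt_A tm k; unfold nSym at this; omega⟩
  else 0

/-- The code of an optional symbol (`none` = empty cell = code `0`). [folklore] -/
def codeOpt (k : tm.K) : Option (tm.Γ k) → Fin (A tm)
  | none => 0
  | some γ => code tm k γ

/-- Decoding a cell code on stack `k` (`none` for the empty code and for junk). [folklore] -/
def decode (k : tm.K) (g : Fin (A tm)) : Option (tm.Γ k) :=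
  if h : 1 ≤ (g : ℕ) ∧ (g : ℕ) - 1 < nSym tm k then
    some ((Fintype.equivFin (symSet tm k)).symm ⟨(g : ℕ) - 1, h.2⟩).1
  else none

/-- The code of an effective symbol is not the empty code. [folklore] -/
theorem code_ne_zero {k : tm.K} {γ : tm.Γ k} (h : IsSym tm k γ) : code tm k γ ≠ 0 := by
  simp only [code, h, dif_pos, ne_eq, Fin.ext_iff, Fin.val_zero]
  omega

/-- The code of a non-effective symbol is the empty code. [folklore] -/
theorem code_of_not {k : tm.K} {γ : tm.Γ k} (h : ¬ IsSym tm k γ) : code tm k γ = 0 := by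
  simp [code, h]

/-- Decoding the code of an effective symbol. [folklore] -/
theorem decode_code {k : tm.K} {γ : tm.Γ k} (h : IsSym tm k γ) :
    decode tm k (code tm k γ) = some γ := by
  simp only [code, h, dif_pos, decode]
  rw [dif_pos]
  · simp only [Nat.add_sub_cancel, Fin.eta, Equiv.symm_apply_apply]
  · refine ⟨by omega, ?_⟩
    simp only [Nat.add_sub_cancel]
    exact (Fintype.equivFin (symSet tm k) ⟨γ, h⟩).2

/-- Decoding the empty code. [folklore] -/
theorem decode_zero (k : tm.K) : decode tm k 0 = none := by
  simp [decode]

/-- Decoding the code of an optional effective symbol. [folklore] -/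
theorem decode_codeOpt {k : tm.K} {o : Option (tm.Γ k)} (h : ∀ γ, o = some γ → IsSym tm k γ) :
    decode tm k (codeOpt tm k o) = o := by
  cases o with
  | none => exact decode_zero tm k
  | some γ => exact decode_code tm (h γ rfl)

/-- Codes of effective symbols are injective, and differ from the codes of all other
symbols. [folklore] -/
theorem code_eq_code_iff {k : tm.K} {γ₁ γ₂ : tm.Γ k} (h₁ : IsSym tm k γ₁) :
    code tm k γ₁ = code tm k γ₂ ↔ γ₁ = γ₂ := by
  refine ⟨fun h => ?_, fun h => h ▸ rfl⟩
  by_cases h₂ : IsSym tm k γ₂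
  · have := decode_code tm h₂
    rw [← h, decode_code tm h₁] at this
    exact Option.some_injective _ this
  · exact absurd (h.trans (code_of_not tm h₂)) (code_ne_zero tm h₁)

/-- `codeOpt` of an optional effective symbol equals the code of an effective symbol iff
the option is that symbol. [folklore] -/
theorem codeOpt_eq_code_iff {k : tm.K} {o : Option (tm.Γ k)} {γ : tm.Γ k}
    (ho : ∀ γ', o = some γ' → IsSym tm k γ') (hγ : IsSym tm k γ ∨ o ≠ none) :
    codeOpt tm k o = code tm k γ ↔ o = some γ := by
  cases o with
  | none =>
    simp only [codeOpt, reduceCtorEq, iff_false]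
    rcases hγ with hγ | hγ
    · exact fun h => code_ne_zero tm hγ h.symm
    · exact absurd rfl hγ
  | some γ' =>
    simp only [codeOpt, Option.some.injEq]
    exact code_eq_code_iff tm (ho γ' rfl)

/-! ### Decoding windows -/

/-- The longest prefix of `some`s. [folklore] -/
def somePrefix {α : Type} : List (Option α) → List α
  | some a :: l => a :: somePrefix l
  | _ => []

/-- `somePrefix` is not longer than the list. [folklore] -/
theorem length_somePrefix_le {α : Type} : ∀ l : List (Option α), (somePrefix l).length ≤ l.length
  | [] => le_rfl
  | none :: _ => Nat.zero_le _
  | some _ :: l => Nat.succ_le_succ (length_somePrefix_le l)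

/-- `somePrefix` of the list of optional entries `L[0]?, …, L[d-1]?` is `L.take d`.
[folklore] -/
theorem somePrefix_map_getElem? {α : Type} (d : ℕ) (L : List α) :
    somePrefix ((List.finRange d).map fun i : Fin d => L[(i : ℕ)]?) = L.take d := by
  induction d generalizing L with
  | zero => simp [somePrefix]
  | succ d ih =>
    rw [List.finRange_succ, List.map_cons, List.map_map]
    cases L with
    | nil => simp [somePrefix]
    | cons a L =>
      simp only [Fin.val_zero, List.getElem?_cons_zero, somePrefix, List.take_succ_cons,
        List.cons.injEq, true_and]
      rw [← ih L]
      simp only [Function.comp_def, Fin.val_succ, List.getElem?_cons_succ]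

/-- Decoding a window of cell codes on stack `k`: decode cell by cell and keep the longest
prefix of nonempty cells. [folklore] -/
def decodeWin (k : tm.K) {d : ℕ} (f : Fin d → Fin (A tm)) : List (tm.Γ k) :=
  somePrefix ((List.finRange d).map fun i => decode tm k (f i))

/-- A decoded window has at most `d` cells. [folklore] -/
theorem length_decodeWin_le (k : tm.K) {d : ℕ} (f : Fin d → Fin (A tm)) :
    (decodeWin tm k f).length ≤ d := by
  unfold decodeWin
  exact (length_somePrefix_le _).trans (by simp)

/-- **Decoding the coded window of a stack of effective symbols gives its top-`d`
segment.** [folklore] -/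
theorem decodeWin_codeOpt (k : tm.K) (d : ℕ) (L : List (tm.Γ k)) (hL : ∀ γ ∈ L, IsSym tm k γ) :
    decodeWin tm k (fun i : Fin d => codeOpt tm k L[(i : ℕ)]?) = L.take d := by
  unfold decodeWin
  rw [← somePrefix_map_getElem? d L]
  congr 1
  refine List.map_congr_left fun i _ => decode_codeOpt tm fun γ hγ => hL γ ?_
  exact List.mem_of_getElem? hγ

/-! ### The window machine of `tm` -/

/-- Label codes. [folklore] -/
def eL : Option tm.Λ ≃ Fin (Fintype.card (Option tm.Λ)) := Fintype.equivFin _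

/-- State codes. [folklore] -/
def eV : tm.σ ≃ Fin (Fintype.card tm.σ) := Fintype.equivFin _

/-- Stack codes. [folklore] -/
def eK : tm.K ≃ Fin (Fintype.card tm.K) := Fintype.equivFin _

/-- The stack with code `k'`. [folklore] -/
abbrev sk (k' : Fin (Fintype.card tm.K)) : tm.K := (eK tm).symm k'

/-- The (truncated) configuration described by a pattern: decoded label, state and windows.
[folklore] -/
def ctrlCfg (l : Fin (Fintype.card (Option tm.Λ))) (v : Fin (Fintype.card tm.σ))
    (w : Fin (Fintype.card tm.K) → Fin (depth tm) → Fin (A tm)) : tm.Cfg :=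
  ⟨(eL tm).symm l, (eV tm).symm v, fun k => decodeWin tm k (w (eK tm k))⟩

/-- **The window machine of a `TM2` machine**: label codes `Option Λ`, state codes `σ`,
`κ = #K` stacks, cell codes `Fin A`, window depth `depth tm`; the control table decodes a
pattern into a truncated configuration, runs one total step of `tm` on it and re-encodes the
new label, state and top segments (of length `≤ 2 · depth`, `TM2Sim.length_stepTotal_le`).
[Sipser 2012, proof of Thm. 9.30; Arora–Barak 2009, proof of Thm. 6.6]
[cite: Sipser2012, Thm. 9.30 (proof)] -/
abbrev wm : WM where
  nL := Fintype.card (Option tm.Λ)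
  nV := Fintype.card tm.σ
  κ := Fintype.card tm.K
  A := A tm
  d := depth tm
  ctrl l v w :=
    ((eL tm) (stepTotal tm (ctrlCfg tm l v w)).l, (eV tm) (stepTotal tm (ctrlCfg tm l v w)).var,
      fun k' => ((stepTotal tm (ctrlCfg tm l v w)).stk (sk tm k')).map (code tm (sk tm k')))
  length_ctrl_le l v w k' := by
    rw [List.length_map]
    have h1 := length_stepTotal_le tm (ctrlCfg tm l v w) (sk tm k')
    have h2 : ((ctrlCfg tm l v w).stk (sk tm k')).length ≤ depth tm := length_decodeWin_le tm _ _
    omega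

/-- **The abstraction map**: code a configuration of `tm` as a configuration of its window
machine, cell by cell (`cell k' j` = code of the `j`-th symbol from the top of stack `k'`,
`0` below the bottom). [cite: Sipser2012, Thm. 9.30 (proof)] -/
def abs (c : tm.Cfg) : (wm tm).Cfg :=
  ⟨(eL tm) c.l, (eV tm) c.var, fun k' j => codeOpt tm (sk tm k') ((c.stk (sk tm k'))[j]?)⟩

/-- The label code of `abs c`. [folklore] -/
@[simp] theorem abs_l (c : tm.Cfg) : (abs tm c).l = (eL tm) c.l := rfl

/-- The state code of `abs c`. [folklore] -/
@[simp] theorem abs_v (c : tm.Cfg) : (abs tm c).v = (eV tm) c.var := rfl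

/-- The cells of `abs c`. [folklore] -/
theorem abs_cell (c : tm.Cfg) (k' : Fin (Fintype.card tm.K)) (j : ℕ) :
    (abs tm c).cell k' j = codeOpt tm (sk tm k') ((c.stk (sk tm k'))[j]?) := rfl

/-- The cells of `abs c` on the stack with code `eK k` are the codes of the symbols of stack
`k` (the round trip `sk (eK k) = k` resolved). [folklore] -/
theorem abs_cell_eK (c : tm.Cfg) (k : tm.K) (j : ℕ) :
    (abs tm c).cell (eK tm k) j = codeOpt tm k ((c.stk k)[j]?) := by
  rw [abs_cell]
  have key : ∀ k₁ : tm.K, k₁ = k →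
      codeOpt tm k₁ ((c.stk k₁)[j]?) = codeOpt tm k ((c.stk k)[j]?) := by
    intro k₁ h; subst h; rfl
  exact key _ (Equiv.symm_apply_apply (eK tm) k)

/-- On a good configuration, the configuration decoded from the pattern of `abs c` is the
truncation of `c` to its top windows. [folklore] -/
theorem ctrlCfg_pat {c : tm.Cfg} (hc : Good tm c) :
    ctrlCfg tm ((wm tm).pat (abs tm c)).1 ((wm tm).pat (abs tm c)).2.1
      ((wm tm).pat (abs tm c)).2.2 = truncate tm (depth tm) c := by
  have hstk : ∀ k, decodeWin tm k (((wm tm).pat (abs tm c)).2.2 (eK tm k)) =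
      (c.stk k).take (depth tm) := by
    intro k
    have key : ∀ k₁ : tm.K, k₁ = k →
        decodeWin tm k (fun i : Fin (depth tm) => codeOpt tm k₁ ((c.stk k₁)[(i : ℕ)]?)) =
          (c.stk k).take (depth tm) := by
      intro k₁ h
      subst h
      exact decodeWin_codeOpt tm _ (depth tm) _ (hc _)
    exact key _ (Equiv.symm_apply_apply (eK tm) k)
  show (⟨(eL tm).symm ((wm tm).pat (abs tm c)).1, (eV tm).symm ((wm tm).pat (abs tm c)).2.1,
      fun k => decodeWin tm k (((wm tm).pat (abs tm c)).2.2 (eK tm k))⟩ : tm.Cfg) =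
    ⟨c.l, c.var, fun k => (c.stk k).take (depth tm)⟩
  have h1 : (eL tm).symm ((wm tm).pat (abs tm c)).1 = c.l := Equiv.symm_apply_apply _ _
  have h2 : (eV tm).symm ((wm tm).pat (abs tm c)).2.1 = c.var := Equiv.symm_apply_apply _ _
  rw [h1, h2]
  exact congrArg (fun stk => (⟨c.l, c.var, stk⟩ : tm.Cfg)) (funext hstk)

/-- **`abs` commutes with one step** (on good configurations): the window machine of `tm`
simulates `tm`. [Sipser 2012, proof of Thm. 9.30; Arora–Barak 2009, proof of Thm. 6.6]
[cite: Sipser2012, Thm. 9.30 (proof)] -/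
theorem abs_stepTotal {c : tm.Cfg} (hc : Good tm c) :
    abs tm (stepTotal tm c) = (wm tm).step (abs tm c) := by
  have hctrl := ctrlCfg_pat tm hc
  have hwin := stepTotal_window tm c (depth tm) le_rfl
  refine WM.Cfg.ext ?_ ?_ (funext fun k' => funext fun j => ?_)
  · -- label
    show (eL tm) (stepTotal tm c).l = (eL tm) (stepTotal tm (ctrlCfg tm _ _ _)).l
    rw [hctrl, hwin]
    rfl
  · -- state
    show (eV tm) (stepTotal tm c).var = (eV tm) (stepTotal tm (ctrlCfg tm _ _ _)).var
    rw [hctrl, hwin]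
    rfl
  · -- cells
    show (abs tm (stepTotal tm c)).cell k' j =
      (if h : j < (((stepTotal tm (ctrlCfg tm _ _ _)).stk (sk tm k')).map (code tm (sk tm k'))).length
        then (((stepTotal tm (ctrlCfg tm _ _ _)).stk (sk tm k')).map (code tm (sk tm k')))[j]
        else (abs tm c).cell k' (j - (((stepTotal tm (ctrlCfg tm _ _ _)).stk (sk tm k')).map
          (code tm (sk tm k'))).length + depth tm))
    rw [hctrl, abs_cell, abs_cell, getElem?_stepTotal_stk tm c (depth tm) le_rfl (sk tm k') j]
    simp only [List.length_map]
    split_ifs with hj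
    · rw [List.getElem?_eq_getElem hj, List.getElem_map]
      rfl
    · rfl

/-- **`abs` commutes with runs** (good configurations stay good). [cite: Sipser2012, Thm. 9.30 (proof)] -/
theorem abs_iterate {c : tm.Cfg} (hc : Good tm c) (t : ℕ) :
    abs tm ((stepTotal tm)^[t] c) = (wm tm).step^[t] (abs tm c) := by
  induction t with
  | zero => rfl
  | succ t ih =>
    rw [iterate_succ_apply', iterate_succ_apply', ← ih]
    exact abs_stepTotal tm (Good.iterate tm hc t)

/-! ### Reading initial and halting configurations -/

/-- The label code of an initial configuration. [folklore] -/
theorem abs_initList_l (s : List (tm.Γ tm.k₀)) :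
    (abs tm (initList tm s)).l = (eL tm) (some tm.main) := rfl

/-- The state code of an initial configuration. [folklore] -/
theorem abs_initList_v (s : List (tm.Γ tm.k₀)) :
    (abs tm (initList tm s)).v = (eV tm) tm.initialState := rfl

/-- The input-stack cells of an initial configuration. [folklore] -/
theorem abs_initList_cell_input (s : List (tm.Γ tm.k₀)) (j : ℕ) :
    (abs tm (initList tm s)).cell (eK tm tm.k₀) j = codeOpt tm tm.k₀ (s[j]?) := by
  rw [abs_cell_eK, TM2Comp.initList_eq]
  simp

/-- The other cells of an initial configuration are empty. [folklore] -/
theorem abs_initList_cell_of_ne (s : List (tm.Γ tm.k₀)) {k' : Fin (Fintype.card tm.K)}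
    (hk : k' ≠ eK tm tm.k₀) (j : ℕ) : (abs tm (initList tm s)).cell k' j = 0 := by
  rw [abs_cell, TM2Comp.initList_eq]
  have : sk tm k' ≠ tm.k₀ := fun h => hk (by rw [← h]; simp [sk])
  simp [update_of_ne this, codeOpt]

/-- The label code of a halting configuration. [folklore] -/
theorem abs_haltList_l (s : List (tm.Γ tm.k₁)) :
    (abs tm (haltList tm s)).l = (eL tm) none := rfl

/-- Cell `0` of the output stack of a halting configuration. [folklore] -/
theorem abs_haltList_cell (s : List (tm.Γ tm.k₁)) :
    (abs tm (haltList tm s)).cell (eK tm tm.k₁) 0 = codeOpt tm tm.k₁ (s[0]?) := by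
  rw [abs_cell_eK, TM2Comp.haltList_eq]
  simp

/-- The output symbol of a good halting configuration is effective. [folklore] -/
theorem isSym_of_good_haltList {γ : tm.Γ tm.k₁} {s : List (tm.Γ tm.k₁)}
    (h : Good tm (haltList tm (γ :: s))) : IsSym tm tm.k₁ γ := by
  have := h tm.k₁ γ
  rw [TM2Comp.haltList_eq] at this
  exact this (by simp)

end TM2Bridge

end Literature.Computability.QuantumComplexity
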